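import Summits.AtomisticToContinuum.HydrodynamicLimit.Theorems.TwoClocksClampedTransferWindowLDStubStationaryTruncation

/-!
# Line `Sketch`, rung R2: the clamp-deficit bound (crux `TwoClocks.ClampedTransferWindowLD` = C′, stmt-AtomisticToContinuum-16623)

Registered stub `stub_clampDeficitBound` of the lead's skeleton `Cruxes/ClampedTransferWindowLD/Lines/Sketch.lean` (card
`Ideas/stationary-truncation-clamp-deficit.md`, `ClampDeficitBound`): Markov's inequality on top of the landed rung R1
`SketchLine.stub_stationaryTruncation` (Jensen along window concatenation under the flow-invariant Gibbs law). For `M < V` the clamp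
deficit `G_N(act_i^{(Kτ₁)} > V)` of the transfer-activity clamp of C′ over the window of length `K·τ₁` is at most
`(V − M)⁻¹ · E_G (act_i^{(τ₁)} − M)₊` — a ONE-window tail functional, uniformly in `K ≥ 1` and `N` (the V-uniform half of the
tagged-particle transfer-activity law of large numbers (F2); the fixed-V decay in τ stays open). Lead prover-line-stmt-AtomisticToContinuum-16623-0.
-/

noncomputable section

open MeasureTheory ProbabilityTheory Set Filter
open scoped ENNReal BigOperators
open Literature.Analysis.FluidPDE Literature.MathematicalPhysics.KineticTheory
open Literature.Analysis.FunctionSpaces (Torus.partialDeriv Torus.IsSmooth)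

namespace Summit.AtomisticToContinuum.HydrodynamicLimit.Theorems.ClampedTransferCoin

/-- The window transfer activity of particle `i` (normalisation `τ`, window `window τ N`) is `G_N`-a.e. measurable, for every real
`τ` and all constant profiles (`0 < σ < 1/2`: the Gibbs law is carried by the good set, on which the collision bookkeeping is measurable). -/
theorem aemeasurable_runAct_window_gibbs {σ : ℝ} {N : ℕ} (hσ : 0 < σ) (hσ2 : σ < 1 / 2) (a₀ θ₀ : ℝ) (u₀ : V3)
    (τ : ℝ) (Φ : Flow σ N) (i : Fin (N + 1)) :
    AEMeasurable (runAct σ τ Φ (window τ N) i) (gibbs σ a₀ θ₀ u₀ N Φ) :=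
  aemeasurable_of_measurable_indicator_good Φ (measurable_indicator_runAct_window hσ hσ2 τ Φ i)
    (gibbs_compl_good σ a₀ θ₀ u₀ N Φ)

namespace SketchLine

/-- **R2 · clamp-deficit bound** (registered stub of the line `Sketch`; card stationary-truncation-clamp-deficit, `ClampDeficitBound`):
for `M < V`, `K ≥ 1`, the Gibbs probability that the transfer activity over the window `K·τ₁` exceeds `V` is at most
`(V − M)⁻¹ · ∫⁻ (act^{(τ₁)} − M)₊ dG_N`. Markov's inequality (`meas_ge_le_lintegral_div`) for `(act^{(Kτ₁)} − M)₊ ≥ V − M` on the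
event, then R1 `stub_stationaryTruncation`. -/
theorem stub_clampDeficitBound :
    ∀ (σ a₀ θ₀ : ℝ) (u₀ : V3) (τ₁ M V : ℝ) (N : ℕ) (Φ : Flow σ N) (i : Fin (N + 1)) (K : ℕ),
      0 < σ → σ < 1 / 2 → 0 < τ₁ → 1 ≤ K → M < V →
        (gibbs σ a₀ θ₀ u₀ N Φ) {z | V < runAct σ (K * τ₁) Φ (window (K * τ₁) N) i z} ≤
          (ENNReal.ofReal (V - M))⁻¹ *
            ∫⁻ z, ENNReal.ofReal (runAct σ τ₁ Φ (window τ₁ N) i z - M) ∂(gibbs σ a₀ θ₀ u₀ N Φ) := by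
  intro σ a₀ θ₀ u₀ τ₁ M V N Φ i K hσ hσ2 hτ₁ hK hMV
  set G := gibbs σ a₀ θ₀ u₀ N Φ with hG
  set f : Phase N → ℝ≥0∞ := fun z => ENNReal.ofReal (runAct σ (K * τ₁) Φ (window (K * τ₁) N) i z - M) with hf
  have hfm : AEMeasurable f G :=
    ENNReal.measurable_ofReal.comp_aemeasurable
      ((aemeasurable_runAct_window_gibbs hσ hσ2 a₀ θ₀ u₀ (K * τ₁) Φ i).sub aemeasurable_const)
  have hε0 : ENNReal.ofReal (V - M) ≠ 0 := (ENNReal.ofReal_pos.2 (sub_pos.2 hMV)).ne'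
  have hεtop : ENNReal.ofReal (V - M) ≠ ∞ := ENNReal.ofReal_ne_top
  -- the event is contained in `{V - M ≤ f}`
  have hsub : {z | V < runAct σ (K * τ₁) Φ (window (K * τ₁) N) i z} ⊆ {z | ENNReal.ofReal (V - M) ≤ f z} := by
    intro z hz
    simp only [Set.mem_setOf_eq] at hz ⊢
    exact ENNReal.ofReal_le_ofReal (by linarith)
  -- Markov, then R1
  have hR1 := stub_stationaryTruncation σ a₀ θ₀ u₀ τ₁ M N Φ i K hσ hσ2 hτ₁ hK
  calc G {z | V < runAct σ (K * τ₁) Φ (window (K * τ₁) N) i z}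
      ≤ G {z | ENNReal.ofReal (V - M) ≤ f z} := measure_mono hsub
    _ ≤ (∫⁻ z, f z ∂G) / ENNReal.ofReal (V - M) := meas_ge_le_lintegral_div hfm hε0 hεtop
    _ ≤ (∫⁻ z, ENNReal.ofReal (runAct σ τ₁ Φ (window τ₁ N) i z - M) ∂G) / ENNReal.ofReal (V - M) := by
        gcongr
    _ = (ENNReal.ofReal (V - M))⁻¹ *
          ∫⁻ z, ENNReal.ofReal (runAct σ τ₁ Φ (window τ₁ N) i z - M) ∂G := by
        rw [div_eq_mul_inv, mul_comm]

end SketchLine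

end Summit.AtomisticToContinuum.HydrodynamicLimit.Theorems.ClampedTransferCoin

end
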